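/-
Copyright (c) 2026 the pub-hodgecm-mathlib formalisation cell (harness21).  Prover seat hodgecm-mathlib-F0P2-p01 (g26); E1 keeper ∕ dealer
F0P3a-p03 (g29) (E1 ledger row 44 «EP FUNCTION: VALUE AT ONE», LEAD F0P3a-plan (g16) rule-20 generic brick); 2026-09-03.
-/
import Literature.NumberTheory.Automorphic.SmoothCharacterEPFunctionTrace   -- ★ row 42 (this seat): `smoothTrace_epFunction`, the letters `hUP hPU τ hτ hfP hf0`; brings ★ K-TYPE TRACE
import HarnessLib

/-!
# The Euler–Poincaré-type function `Σ_i (−1)^{d_i} vol(P_i)⁻¹ · 𝟙_{P_i} χ_{W_i}(·⁻¹)`: value at `1`, support, conjugation invariance (Schneider–Stuhler 1997 §III.4; Kottwitz 1988 §2)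

Topic `NumberTheory/Automorphic`; namespace `Representation` (sibling of ★ `SmoothCharacterEPFunctionTrace`, same letters).  THEOREMS ONLY (no definition, no instance, no notation,
no named fact, no `sorry`).  Pure bookkeeping on the functions `f_i = 𝟙_{P_i} · χ_{τ_i}(·⁻¹)` of ★ K-TYPE TRACE (`hfP : f g = χ_τ(g)⁻¹` on `P`, `hf0 : f = 0` off `P`); no measure theory beyond
the volumes `μ.real P_i` appearing as scalars, no representation `π′`.
* §1 ONE `K`-TYPE FUNCTION: `kType_apply_one` (`f_τ(1) = dim W`, Mathlib `Representation.char_one`), `kType_apply_conj` (`f_τ(p g p⁻¹) = f_τ(g)` for `p ∈ P`, Mathlib `char_conj`),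
  `support_kType_subset` (`supp f_τ ⊆ P`).
* §2 THE EP-TYPE FUNCTION `f_EP = Σ_{i ∈ s} (−1)^{d_i} (μ P_i)⁻¹ • f_i`: **`epFunction_apply_one`** (`f_EP(1) = Σ_i (−1)^{d_i} (μ P_i)⁻¹ dim W_i`), **`epFunction_apply_one_ofReal`** ∕
  **`re_epFunction_apply_one`** (the same as a REAL number — the quantity the POS-ONE cell asks to be positive; the sign is NOT claimed here), `support_epFunction_subset`
  (`supp f_EP ⊆ ⋃_{i ∈ s} P_i`), `epFunction_apply_conj` (`f_EP(p g p⁻¹) = f_EP(g)` for `p ∈ ⋂_{i ∈ s} P_i`).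
Consumer (cell `pub/hodgecm-mathlib`, crux H413, E1 RESIDUE MATRIX v1.1, POS-ONE-π² row): `f_EP(1)` of the pseudo-coefficient `f_EP^{π,e}` («`= d(π) > 0`» is the XL analytic half, print).
HONEST LABEL: count-neutral generic base layer; E1 stays PRINT until the charter test; HC_CM is proved only modulo the printed citations until rung 0 closes.

## References
* [SchneiderStuhler1997] P. Schneider, U. Stuhler, *Representation theory and sheaves on the Bruhat–Tits building*, Publ. Math. IHÉS 85 (1997), §III.4.
* [Kottwitz1988] R. E. Kottwitz, *Tamagawa numbers*, Ann. of Math. 127 (1988), §2 (the Euler–Poincaré function and `f_EP(1)`).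
* [Serre1977] J.-P. Serre, *Linear Representations of Finite Groups*, GTM 42 (1977), §2.1 (`χ(1) = dim`, class functions).
-/

set_option autoImplicit false

open MeasureTheory
open scoped BigOperators

namespace Representation

open Literature.NumberTheory.Automorphic

variable {G : Type*} [Group G]

/-! ## §1 One `K`-type function `f_τ = 𝟙_P · χ_τ(·⁻¹)` -/

section OneKType

variable {P : Subgroup G} {W : Type*} [AddCommGroup W] [Module ℂ W] (τ : Representation ℂ P W)
  {f : G → ℂ} (hfP : ∀ (g : G) (hg : g ∈ P), f g = τ.character ⟨g, hg⟩⁻¹) (hf0 : ∀ g ∉ P, f g = 0)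

include hfP in
/-- **`f_τ(1) = dim W`** (`χ_τ(1) = dim W`, Mathlib `Representation.char_one`). [cite: Serre1977, §2.1] [cite: Kottwitz1988, §2] -/
theorem kType_apply_one [FiniteDimensional ℂ W] : f 1 = Module.finrank ℂ W := by
  rw [hfP 1 P.one_mem]
  have h1 : (⟨1, P.one_mem⟩ : P) = 1 := rfl
  rw [h1, inv_one, char_one]

include hfP hf0 in
/-- **`f_τ` is a class function of `P`**: `f_τ(p g p⁻¹) = f_τ(g)` for `p ∈ P` (on `P` by Mathlib `Representation.char_conj`; off `P` both sides vanish). [cite: Serre1977, §2.1] -/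
theorem kType_apply_conj {p : G} (hp : p ∈ P) (g : G) : f (p * g * p⁻¹) = f g := by
  by_cases hg : g ∈ P
  · have hpgp : p * g * p⁻¹ ∈ P := P.mul_mem (P.mul_mem hp hg) (P.inv_mem hp)
    rw [hfP _ hpgp, hfP g hg]
    have hinv : (⟨p * g * p⁻¹, hpgp⟩ : P)⁻¹ = ⟨p, hp⟩ * (⟨g, hg⟩ : P)⁻¹ * (⟨p, hp⟩ : P)⁻¹ := by
      apply Subtype.ext
      simp only [Subgroup.coe_inv, Subgroup.coe_mul, mul_inv_rev, inv_inv, mul_assoc]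
    rw [hinv, char_conj]
  · have hpgp : p * g * p⁻¹ ∉ P := fun h => hg (by
      have key : p⁻¹ * (p * g * p⁻¹) * p = g := by group
      exact key ▸ P.mul_mem (P.mul_mem (P.inv_mem hp) h) hp)
    rw [hf0 _ hpgp, hf0 g hg]

include hf0 in
/-- **`supp f_τ ⊆ P`**. [cite: Kottwitz1988, §2] -/
theorem support_kType_subset : Function.support f ⊆ (P : Set G) :=
  fun g hg => by_contra fun h => hg (hf0 g h)

end OneKType

/-! ## §2 The Euler–Poincaré-type function `Σ_{i ∈ s} (−1)^{d_i} (μ P_i)⁻¹ • f_i` -/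

section EPFunction

variable [MeasurableSpace G] (μ : Measure G)
  {ι : Type*} (s : Finset ι) (P : ι → Subgroup G) {W : ι → Type*} [∀ i, AddCommGroup (W i)] [∀ i, Module ℂ (W i)]
  (τ : ∀ i, Representation ℂ (P i) (W i)) (f : ι → G → ℂ) (d : ι → ℕ)

/-- **`f_EP(1) = Σ_{i ∈ s} (−1)^{d_i} (μ P_i)⁻¹ dim W_i`**. [cite: Kottwitz1988, §2] [cite: SchneiderStuhler1997, III.4] -/
theorem epFunction_apply_one [∀ i, FiniteDimensional ℂ (W i)] (hfP : ∀ i ∈ s, ∀ (g : G) (hg : g ∈ P i), f i g = (τ i).character ⟨g, hg⟩⁻¹) :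
    (∑ i ∈ s, ((-1 : ℂ) ^ d i) • ((μ.real (P i : Set G) : ℂ))⁻¹ • f i) 1 =
      ∑ i ∈ s, (-1 : ℂ) ^ d i * ((μ.real (P i : Set G) : ℂ))⁻¹ * Module.finrank ℂ (W i) := by
  rw [Finset.sum_apply]
  exact Finset.sum_congr rfl fun i hi => by
    rw [Pi.smul_apply, Pi.smul_apply, smul_eq_mul, smul_eq_mul, kType_apply_one (τ i) (hfP i hi), mul_assoc]

/-- **`f_EP(1)` is the real number `Σ_{i ∈ s} (−1)^{d_i} (μ P_i)⁻¹ dim W_i`** (cast to `ℂ`). [cite: Kottwitz1988, §2] -/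
theorem epFunction_apply_one_ofReal [∀ i, FiniteDimensional ℂ (W i)] (hfP : ∀ i ∈ s, ∀ (g : G) (hg : g ∈ P i), f i g = (τ i).character ⟨g, hg⟩⁻¹) :
    (∑ i ∈ s, ((-1 : ℂ) ^ d i) • ((μ.real (P i : Set G) : ℂ))⁻¹ • f i) 1 =
      ((∑ i ∈ s, (-1 : ℝ) ^ d i * (μ.real (P i : Set G))⁻¹ * (Module.finrank ℂ (W i) : ℝ) : ℝ) : ℂ) := by
  rw [epFunction_apply_one μ s P τ f d hfP]
  push_cast
  rfl

/-- **`Re f_EP(1) = Σ_{i ∈ s} (−1)^{d_i} (μ P_i)⁻¹ dim W_i`** — the quantity the POS-ONE statement («`f_EP(1) = d(π) > 0`») is about; the SIGN is not claimed here.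
[cite: Kottwitz1988, §2] [cite: SchneiderStuhler1997, III.4] -/
theorem re_epFunction_apply_one [∀ i, FiniteDimensional ℂ (W i)] (hfP : ∀ i ∈ s, ∀ (g : G) (hg : g ∈ P i), f i g = (τ i).character ⟨g, hg⟩⁻¹) :
    ((∑ i ∈ s, ((-1 : ℂ) ^ d i) • ((μ.real (P i : Set G) : ℂ))⁻¹ • f i) 1).re =
      ∑ i ∈ s, (-1 : ℝ) ^ d i * (μ.real (P i : Set G))⁻¹ * (Module.finrank ℂ (W i) : ℝ) := by
  rw [epFunction_apply_one_ofReal μ s P τ f d hfP, Complex.ofReal_re]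

omit [MeasurableSpace G] in
/-- **`supp f_EP ⊆ ⋃_{i ∈ s} P_i`**. [cite: Kottwitz1988, §2] -/
theorem support_epFunction_subset (c : ι → ℂ) (hf0 : ∀ i ∈ s, ∀ g ∉ P i, f i g = 0) :
    Function.support (∑ i ∈ s, c i • f i) ⊆ ⋃ i ∈ s, (P i : Set G) := by
  intro g hg
  rw [Function.mem_support, Finset.sum_apply] at hg
  by_contra hnot
  apply hg
  refine Finset.sum_eq_zero fun i hi => ?_
  have hgi : g ∉ P i := fun h => hnot (Set.mem_biUnion (Finset.mem_coe.2 hi) h)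
  rw [Pi.smul_apply, hf0 i hi g hgi, smul_zero]

omit [MeasurableSpace G] in
/-- **`f_EP` is invariant under conjugation by `⋂_{i ∈ s} P_i`**: `f_EP(p g p⁻¹) = f_EP(g)` (each summand is a class function of its `P_i`, §1). [cite: Serre1977, §2.1] [cite: Kottwitz1988, §2] -/
theorem epFunction_apply_conj (c : ι → ℂ) (hfP : ∀ i ∈ s, ∀ (g : G) (hg : g ∈ P i), f i g = (τ i).character ⟨g, hg⟩⁻¹) (hf0 : ∀ i ∈ s, ∀ g ∉ P i, f i g = 0)
    {p : G} (hp : ∀ i ∈ s, p ∈ P i) (g : G) :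
    (∑ i ∈ s, c i • f i) (p * g * p⁻¹) = (∑ i ∈ s, c i • f i) g := by
  rw [Finset.sum_apply, Finset.sum_apply]
  exact Finset.sum_congr rfl fun i hi => by
    rw [Pi.smul_apply, Pi.smul_apply, kType_apply_conj (τ i) (hfP i hi) (hf0 i hi) (hp i hi) g]

end EPFunction

end Representation
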